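import Mathlib
import HarnessLib.Audit
import Summits.PneNP.PneNP.Theorems.PstarGateNodesX
import Summits.PneNP.PneNP.Theorems.PstarGateCompanion
import Summits.PneNP.PneNP.Theorems.PstarChordBridgeCornerUnit

/-!
# One GATED chord, node N5 (the doubly-read companion chord): the CORNER DICHOTOMY via the clean companion (E2; prover-1 g19)

FRONTIER range-avoidance ladder, rung F-N3 (`stmt-PneNP-19007`), cell `pnp-ideate` (`PstarGateNodesX.GateU2X`; predecessor's `E2-PLAN-v3.md` §2);
restricted-model proof complexity — nothing here bears on `P` versus `NP`.

`N = {e, e'}`, `e` gated (`ρ_e = (ℓ, 0)`, `ℓ = κ₀ + x_u`), `e'` read in two INDEPENDENT constant directions `r, r'`.  The clean companion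
`B₀ = companion I B e g₀ u κ₀` (`PstarGateCompanion`: chords `{e'}`, first constraint `F₁ + ℓ`) is infeasible (`infeasible_companion`) and its chord
`e'` keeps the reads `r, r'`, so the clean (U2) corner applies to it WITHOUT any minimality transfer:

* `qDir_companion_dir` — `q̃_m := qDir B₀ m = qDir B m + m₂·ℓ` (the companion's directional constraint);
* `u2_factor` — **`u_{e'} = q̃_{r'}·q̃_r + 1`** on the whole cube (`PstarChordBridgeCorner.u_eq_prod_of_corner` on `B₀`);
* `u2_corner_cases` — by `PstarChordBridgeCornerUnit.dir_cases_of_factor` on `B₀` (no (M0) needed): EITHER `D e'` is a CONS-T pair (two tree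
  edges with disjoint AND pairs, literals `σ, τ` realised together by a join edge or a private-free pendant of the companion — i.e. of `B` minus
  `g₀`), OR both factors are trivial: each of `q̃_r`, `q̃_{r'}` is `≡ 1` or equals `Q_{D e'} + γ' + 1`, and not both are `≡ 1`.
-/

set_option linter.dupNamespace false -- `Summit.PneNP.PneNP.…`: summit = sub-problem name (D-0017 single-conjunct layout)

open Finset Literature.Computability.Complexity
open scoped symmDiff
open Summit.PneNP.PneNP.Theorems.PstarFibrePolys (bit bit_xor)
open Summit.PneNP.PneNP.Theorems.PstarTyped (Typed)
open Summit.PneNP.PneNP.Theorems.PstarSALevel (BoundaryExpanding SimpleOverlap)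
open Summit.PneNP.PneNP.Theorems.PstarGapLinearised (andPair)
open Summit.PneNP.PneNP.Theorems.PstarXCore (xverts)
open Summit.PneNP.PneNP.Theorems.PstarProductRank (qform)
open Summit.PneNP.PneNP.Theorems.PstarForcing (exists_ne_of_rank_four)
open Summit.PneNP.PneNP.Theorems.PstarReadSumset (V2)
open Summit.PneNP.PneNP.Theorems.PstarChordSystem (ChordSystem)
open Summit.PneNP.PneNP.Theorems.PstarChordBridgeTools (privs coef)
open Summit.PneNP.PneNP.Theorems.PstarChordBridge (BridgeData sys Solution Lift infeasible_of_not_solution)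
open Summit.PneNP.PneNP.Theorems.PstarChordBridgeForcing (gam freeMon sys_u_eq qform_add' rank_four_of_wf)
open Summit.PneNP.PneNP.Theorems.PstarChordBridgeBasis (qDir)
open Summit.PneNP.PneNP.Theorems.PstarChordBridgeCorner (u_eq_prod_of_corner)
open Summit.PneNP.PneNP.Theorems.PstarChordBridgeCornerUnit (dir_cases_of_factor)
open Summit.PneNP.PneNP.Theorems.PstarGateBridge (GateHyp const_of_others)
open Summit.PneNP.PneNP.Theorems.PstarGateTerminal (coef_single_gate)
open Summit.PneNP.PneNP.Theorems.PstarGateCompanion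
open Summit.PneNP.PneNP.Theorems.PstarGateNodes (GateData)
open Summit.PneNP.PneNP.Theorems.PstarGateNodesX (GateDataX)

namespace Summit.PneNP.PneNP.Theorems.PstarGateU2Corner

variable {n m : ℕ}

/-- Every element of `𝔽₂` is `0` or `1`. -/
private theorem zmod2_cases (t : ZMod 2) : t = 0 ∨ t = 1 := by
  revert t; decide

/-- **The companion's directional constraint**: `qDir B₀ m = qDir B m + m₂·ℓ` (`ℓ = coef` of the gated private). -/
theorem qDir_companion_dir (I : LocalMap 4 n m) (hI : I.IsPure xorAndPred) {B : BridgeData n m} (hW : B.WF I) {e : Fin m} (hG : GateHyp I B e)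
    {g₀ : Fin m} (hg₀ : g₀ ∈ B.G₁) {u : Fin n} (hgv : (I.vars g₀ 2 = I.vars e 2 ∧ I.vars g₀ 3 = u) ∨ (I.vars g₀ 2 = u ∧ I.vars g₀ 3 = I.vars e 2))
    (hu : u ∉ privs I B.N) (hux : u ∉ xverts I (B.J₀ \ B.N)) (hG₁p : ∀ g ∈ B.G₁.erase g₀, I.vars g 2 ≠ I.vars e 2 ∧ I.vars g 3 ≠ I.vars e 2)
    (mv : V2) (x : Fin n → ZMod 2) :
    qDir I (companion I B e g₀ u (decide (I.vars e 2 ∈ B.C₁))) mv x = qDir I B mv x + mv.2 * coef I B.C₁ B.G₁ (I.vars e 2) x := by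
  classical
  unfold PstarChordBridgeBasis.qDir
  rw [companion_y, companion_J₀, companion_N, companion_T₁, companion_C₁, companion_G₁, companion_b₁, companion_T₂, companion_C₂, companion_G₂,
    companion_b₂, free₁_companion I hI hW hG hg₀ hgv hu hux hG₁p x, free₂_companion I hI hW hG x, coef_single_gate I hI hg₀ hgv hG₁p x, bit_xor]
  have hb : bit (decide (I.vars e 2 ∈ B.C₁)) = if I.vars e 2 ∈ B.C₁ then 1 else 0 := by
    by_cases h : I.vars e 2 ∈ B.C₁
    · rw [if_pos h, decide_eq_true h]; rfl
    · rw [if_neg h, decide_eq_false h]; rfl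
  rw [hb]
  ring

/-- **The U2 factorisation**: `u_{e'} = q̃_{r'}·q̃_r + 1` for the doubly-read companion chord `e'` of one-gate bridge data. -/
theorem u2_factor (I : LocalMap 4 n m) (hI : I.IsPure xorAndPred) (hT : Typed I) {r₀ : ℕ} {B : BridgeData n m} {e g₀ : Fin m} {u : Fin n}
    {κ₀ : ZMod 2} (hD : GateDataX I r₀ B e g₀ u κ₀) {e' : Fin m} (hN : B.N = {e, e'}) (hne : e' ≠ e)
    (hU2 : ∀ a, (sys I B).ρ e' a ≠ 0 ∧ (sys I B).ρ' e' a ≠ 0 ∧ (sys I B).ρ e' a ≠ (sys I B).ρ' e' a) (x : Fin n → ZMod 2) :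
    (sys I B).u e' x =
      qDir I (companion I B e g₀ u (decide (I.vars e 2 ∈ B.C₁))) ((sys I B).ρ' e' 0) x *
        qDir I (companion I B e g₀ u (decide (I.vars e 2 ∈ B.C₁))) ((sys I B).ρ e' 0) x + 1 := by
  classical
  obtain ⟨-, hW, -, -, -, hL, -, -, hG, hg₀, hgv, -, hup, hux, hG₁p, -, hT3, -⟩ := id hD
  set B₀ := companion I B e g₀ u (decide (I.vars e 2 ∈ B.C₁)) with hB₀
  have he' : e' ∈ B.N := by rw [hN]; exact mem_insert_of_mem (mem_singleton_self _)
  have he'₀ : e' ∈ B.N.erase e := mem_erase.2 ⟨hne, he'⟩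
  have hN₀ : B.N.erase e = {e'} := by
    rw [hN]
    ext f
    simp only [mem_erase, mem_insert, mem_singleton]
    constructor
    · rintro ⟨hfe, hf | hf⟩
      · exact absurd hf hfe
      · exact hf
    · intro hf; exact ⟨hf ▸ hne, Or.inr hf⟩
  have hinf : (sys I B).Infeasible B.N := infeasible_of_not_solution I hI hT hW hL hT3
  have hinf₀ : (sys I B₀).Infeasible {e'} := by
    have h := infeasible_companion I hI hW hG hg₀ hgv hup hux hG₁p hinf
    rw [hN₀] at h
    exact h
  have hconst := const_of_others I hW hG
  have hρ₀ : ∀ a, (sys I B₀).ρ e' a = (sys I B).ρ e' 0 := fun a => by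
    rw [(sys_companion_ρ I hW hG hg₀ hgv hup (decide (I.vars e 2 ∈ B.C₁)) he'₀ a).1]; exact (hconst e' he' hne a 0).1
  have hρ'₀ : ∀ a, (sys I B₀).ρ' e' a = (sys I B).ρ' e' 0 := fun a => by
    rw [(sys_companion_ρ I hW hG hg₀ hgv hup (decide (I.vars e 2 ∈ B.C₁)) he'₀ a).2]; exact (hconst e' he' hne a 0).2
  obtain ⟨hr, hr', hrr'⟩ := hU2 0
  have hu : (sys I B₀).u e' x = (sys I B).u e' x := rfl
  rw [← hu]
  exact u_eq_prod_of_corner I B₀ hr hr' hrr' hρ₀ hρ'₀ hinf₀ x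

/-- **The corner dichotomy for the doubly-read companion chord.**  One-gate bridge data with `N = {e, e'}`, `e'` doubly read: EITHER `D e'` is a
CONS-T pair realised by a join edge / private-free pendant of the companion, OR each factor `q̃_m` (`m = r, r'`) is `≡ 1` or `= Q_{D e'} + γ' + 1`. -/
theorem u2_corner_cases (I : LocalMap 4 n m) (hI : I.IsPure xorAndPred) (hT : Typed I) (hS : SimpleOverlap I) {r₀ : ℕ}
    (hB : BoundaryExpanding r₀ I) {B : BridgeData n m} {e g₀ : Fin m} {u : Fin n} {κ₀ : ZMod 2} (hD : GateDataX I r₀ B e g₀ u κ₀)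
    {e' : Fin m} (hN : B.N = {e, e'}) (hne : e' ≠ e)
    (hU2 : ∀ a, (sys I B).ρ e' a ≠ 0 ∧ (sys I B).ρ' e' a ≠ 0 ∧ (sys I B).ρ e' a ≠ (sys I B).ρ' e' a) :
    (∃ j₁ j₂ : Fin m, j₁ ≠ j₂ ∧ B.D e' = {j₁, j₂} ∧ Disjoint (andPair I j₁) (andPair I j₂) ∧
      ∃ σ ∈ andPair I j₁, ∃ τ ∈ andPair I j₂,
        ∃ g ∈ B.T₁ ∪ freeMon I (B.N.erase e) (B.G₁.erase g₀) ∪ (B.T₂ ∪ freeMon I (B.N.erase e) B.G₂), σ ∈ andPair I g ∧ τ ∈ andPair I g) ∨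
    (∀ mv : V2, (mv = (sys I B).ρ e' 0 ∨ mv = (sys I B).ρ' e' 0) →
      (∀ x, qDir I (companion I B e g₀ u (decide (I.vars e 2 ∈ B.C₁))) mv x = 1) ∨
      (∀ x, qDir I (companion I B e g₀ u (decide (I.vars e 2 ∈ B.C₁))) mv x =
        qform (B.D e') (fun j => I.vars j 2) (fun j => I.vars j 3) x + gam B e' + 1)) := by
  classical
  obtain ⟨-, hW, hr, hd₁, hd₂, hL, -, -, hG, hg₀, hgv, -, hup, hux, hG₁p, -, hT3, -⟩ := id hD
  set B₀ := companion I B e g₀ u (decide (I.vars e 2 ∈ B.C₁)) with hB₀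
  have he' : e' ∈ B.N := by rw [hN]; exact mem_insert_of_mem (mem_singleton_self _)
  have he'J : e' ∈ B.J₀ := hW.hN he'
  have he'₀ : e' ∈ B₀.N := by rw [hB₀, companion_N]; exact mem_erase.2 ⟨hne, he'⟩
  have hW₀ : B₀.WF I := companion_wf I hI hT hW hG g₀ hux _
  have hr₀ : (B₀.J₀ ∪ B₀.G₁ ∪ B₀.G₂).card ≤ r₀ := by
    refine le_trans (card_le_card ?_) hr
    rw [hB₀, companion_J₀, companion_G₁, companion_G₂]
    exact union_subset_union (union_subset_union (subset_refl _) (erase_subset _ _)) (subset_refl _)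
  have heG₀ : e' ∉ B₀.G₁ ∪ B₀.G₂ := by
    rw [hB₀, companion_G₁, companion_G₂]
    intro h
    rcases mem_union.1 h with h | h
    · exact disjoint_left.1 hd₁ (mem_of_mem_erase h) he'J
    · exact disjoint_left.1 hd₂ h he'J
  have hfac := u2_factor I hI hT hD hN hne hU2
  have hgam : gam B₀ e' = gam B e' := rfl
  have hDe : B₀.D e' = B.D e' := rfl
  -- non-constancy or triviality of a factor
  have hQnc : ∃ v, qform (B.D e') (fun j => I.vars j 2) (fun j => I.vars j 3) v ≠ qform (B.D e') (fun j => I.vars j 2) (fun j => I.vars j 3) 0 :=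
    exists_ne_of_rank_four (qform_add' I (B.D e')) (rank_four_of_wf I hI hS hB hW
      ((card_le_card (subset_union_left.trans subset_union_left)).trans hr) he')
  -- one direction at a time
  have key : ∀ (mv mv' : V2), (∀ x, (sys I B).u e' x = qDir I B₀ mv' x * qDir I B₀ mv x + 1) →
      (∀ x, qDir I B₀ mv x = 1) ∨ (∀ x, qDir I B₀ mv x = qform (B.D e') (fun j => I.vars j 2) (fun j => I.vars j 3) x + gam B e' + 1) ∨
      (∃ j₁ j₂ : Fin m, j₁ ≠ j₂ ∧ B.D e' = {j₁, j₂} ∧ Disjoint (andPair I j₁) (andPair I j₂) ∧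
        ∃ σ ∈ andPair I j₁, ∃ τ ∈ andPair I j₂,
          ∃ g ∈ B₀.T₁ ∪ freeMon I B₀.N B₀.G₁ ∪ (B₀.T₂ ∪ freeMon I B₀.N B₀.G₂), σ ∈ andPair I g ∧ τ ∈ andPair I g) := by
    intro mv mv' hf
    by_cases hnc : ∃ κ, ∀ x, qDir I B₀ mv x = κ
    · -- a constant factor is `1` (a zero factor would make `u_{e'}` constant)
      left
      obtain ⟨κ, hκ⟩ := hnc
      rcases zmod2_cases κ with rfl | rfl
      · exfalso
        obtain ⟨v, hv⟩ := hQnc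
        have h1 := hf v
        have h0 := hf 0
        rw [hκ, mul_zero, zero_add, sys_u_eq] at h1 h0
        apply hv
        have e2 : ∀ g a b : ZMod 2, g + a = 1 → g + b = 1 → a = b := by decide
        exact e2 _ _ _ h1 h0
      · exact hκ
    · right
      have hF : ∀ x, gam B₀ e' + qform (B₀.D e') (fun j => I.vars j 2) (fun j => I.vars j 3) x = qDir I B₀ mv' x * qDir I B₀ mv x + 1 := by
        intro x; rw [hgam, hDe, ← sys_u_eq]; exact hf x
      rcases dir_cases_of_factor I hI hS hB hW₀ hr₀ he'₀ heG₀ mv hnc hF with h | h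
      · exact Or.inl h
      · exact Or.inr h
  -- both directions
  have hfac' : ∀ x, (sys I B).u e' x = qDir I B₀ ((sys I B).ρ e' 0) x * qDir I B₀ ((sys I B).ρ' e' 0) x + 1 := fun x => by
    rw [mul_comm]; exact hfac x
  have hB₀N : B₀.N = B.N.erase e := rfl
  have hB₀T₁ : B₀.T₁ = B.T₁ := rfl
  have hB₀T₂ : B₀.T₂ = B.T₂ := rfl
  have hB₀G₁ : B₀.G₁ = B.G₁.erase g₀ := rfl
  have hB₀G₂ : B₀.G₂ = B.G₂ := rfl
  rcases key _ _ hfac with h1 | h1 | h1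
  · rcases key _ _ hfac' with h2 | h2 | h2
    · right
      intro mv hmv
      rcases hmv with rfl | rfl
      · exact Or.inl h1
      · exact Or.inl h2
    · right
      intro mv hmv
      rcases hmv with rfl | rfl
      · exact Or.inl h1
      · exact Or.inr h2
    · left; rw [hB₀T₁, hB₀N, hB₀G₁, hB₀T₂, hB₀G₂] at h2; exact h2
  · rcases key _ _ hfac' with h2 | h2 | h2
    · right
      intro mv hmv
      rcases hmv with rfl | rfl
      · exact Or.inr h1
      · exact Or.inl h2
    · right
      intro mv hmv
      rcases hmv with rfl | rfl
      · exact Or.inr h1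
      · exact Or.inr h2
    · left; rw [hB₀T₁, hB₀N, hB₀G₁, hB₀T₂, hB₀G₂] at h2; exact h2
  · left; rw [hB₀T₁, hB₀N, hB₀G₁, hB₀T₂, hB₀G₂] at h1; exact h1

end Summit.PneNP.PneNP.Theorems.PstarGateU2Corner
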